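import Summits.BirchSwinnertonDyer.BirchSwinnertonDyer.Theorems.RamifiedHeegnerPairLeafPartnerOrdersBaseChangeCoordinates
import HarnessLib

/-!
# Route `RamifiedHeegnerPair`, crux U₁ `LeafRankOneUpperAtThree` (stmt-BirchSwinnertonDyer-26022), line `partnerdescent` —
# partner kernel, base change (α) part 3: the hypothesis (C5′) «degree ∣ congruence» read over `S = ℤ₃` by flat base change of a linear system

HONEST FRAMING. Theorems only; helper file (`--supports stmt-BirchSwinnertonDyer-26022 --as helper`); elementary linear algebra over Mathlib,
continuing ‹…LeafPartnerOrdersKernelBaseChange› (p812051, `dvd_dotProduct_of_map_mulVec_eq_zero`) and ‹…BaseChangeCoordinates›; no number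
theory, no named fact, no `sorry`; nothing booked; BSD is proved for no curve. Lead prover bsd-line-rhp-p2 g64, 2026-08-31.

WHY. The local run (`dvd_of_generatorsRun`, p812855) needs (C5′) over `S = ℤ₃`: «for every `s ∈ S[Ĝ]` and `a ∈ S`, if `δ·(s y) = a·P̂ y` on `Ŷ`
then `δ ∣ a` in `S`». The typed input (Papikian–Rabinoff ¶23 + Lemma 24: the JL-degree divides the `qr`-new congruence number) is INTEGRAL:
«for every `C ∈ ℤ[G]` and `a ∈ ℤ`, if `δ·(C y) = a·Ψ(y)·π^*1` on `Y` then `δ ∣ a`». This file is the transfer (LEAD-G63-ASSEMBLY.md §4c (i)):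
writing `s = Σ_k e_k·b̂_k` over finitely many `b_k ∈ ℤ[G]` and testing on finitely many `y_j` spanning `Y`, the condition is a homogeneous
linear system with INTEGER coefficients in the unknowns `(e, a)`; by flatness (`dvd_dotProduct_of_map_mulVec_eq_zero`) every `S`-solution is
an `S`-combination of `ℤ`-solutions, on each of which the integral (C5′) gives `δ ∣ a`. Main theorem `intCast_dvd_of_integral_congruence`.
[cite: PapikianRabinoff2016, §3 ¶23, Lemma 24] [cite: Matsumura1987, Thm. 7.6]
-/

set_option linter.dupNamespace false
set_option autoImplicit false

noncomputable section

namespace Summit.BirchSwinnertonDyer.BirchSwinnertonDyer.Theorems.LeafPartnerOrders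

open Matrix

variable {S : Type*} [CommRing S] [Module.Flat ℤ S] {ι : Type*} [Fintype ι] [DecidableEq ι]
  {K J : Type*} [Fintype K] [DecidableEq K] [Fintype J] [DecidableEq J]

omit [DecidableEq ι] [DecidableEq K] in
/-- `(Σ_k n_k·b_k)·y = Σ_k n_k·(b_k·y)`. [folklore] -/
theorem sum_smul_mulVec {T : Type*} [CommRing T] (n : K → T) (b : K → Matrix ι ι T) (y : ι → T) :
    (∑ k, n k • b k) *ᵥ y = ∑ k, n k • (b k *ᵥ y) := by
  rw [show (∑ k, n k • b k) *ᵥ y = Matrix.mulVec.addMonoidHomLeft y (∑ k, n k • b k) from rfl, map_sum]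
  refine Finset.sum_congr rfl fun k _ ↦ ?_
  change (n k • b k) *ᵥ y = n k • (b k *ᵥ y)
  rw [smul_mulVec]

/-- **(C5′) over `S` from (C5′) over `ℤ`, by flat base change of a linear system.** Data: generators `G` (integer matrices), a sublattice
`Y ≤ ℤ^ι` contained in the span of finitely many `y_j`, the vector `π^*1 = pb1`, an integral functional `Ψ` (= `π_*` on `Y`), the degree `δ`, and the
INTEGRAL hypothesis «`C ∈ ℤ[G]`, `a ∈ ℤ`, `δ·(C y) = a·Ψ(y)·pb1` for all `y ∈ Y` ⟹ `δ ∣ a`». Then for finitely many `b_k ∈ ℤ[G]`,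
coefficients `e_k ∈ S` and `a ∈ S` with `δ·Σ_k e_k·(b̂_k ŷ_j) = a·Ψ(y_j)·pb1^` for every `j`: **`δ ∣ a` in `S`**. Proof: the system in the
unknowns `(e, a) ∈ S^{K ⊔ 1}` has the integer matrix `((j,c),k) ↦ δ·(b_k y_j)_c`, `((j,c),∗) ↦ −Ψ(y_j)·(pb1)_c`; an integer solution `(n, a′)`
gives `C = Σ n_k b_k ∈ ℤ[G]` with `δ·(C y) = a′·Ψ(y)·pb1` on the `y_j`, hence on `Y` (linearity), so `δ ∣ a′`; conclude by
`dvd_dotProduct_of_map_mulVec_eq_zero` (p812051) with the functional «`a`-coordinate». [cite: PapikianRabinoff2016, §3 ¶23, Lemma 24]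
[cite: Matsumura1987, Thm. 7.6] -/
theorem intCast_dvd_of_integral_congruence
    (G : Set (Matrix ι ι ℤ)) (Y : Submodule ℤ (ι → ℤ)) (pb1 : ι → ℤ) (Ψ : (ι → ℤ) →ₗ[ℤ] ℤ) (δ : ℤ)
    (hC5 : ∀ C ∈ Algebra.adjoin ℤ G, ∀ a : ℤ, (∀ y ∈ Y, δ • (C *ᵥ y) = a • Ψ y • pb1) → δ ∣ a)
    (b : K → Matrix ι ι ℤ) (hb : ∀ k, b k ∈ Algebra.adjoin ℤ G)
    (yv : J → (ι → ℤ)) (hYle : Y ≤ Submodule.span ℤ (Set.range yv))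
    (e : K → S) (a : S)
    (hsol : ∀ j, (δ : S) • ∑ k, e k • ((b k).map (Int.castRingHom S) *ᵥ fun c ↦ ((yv j c : ℤ) : S)) =
      a • (((Ψ (yv j) : ℤ) : S) • fun c ↦ ((pb1 c : ℤ) : S))) :
    (δ : S) ∣ a := by
  classical
  -- the integer matrix of the system and the functional «`a`-coordinate»
  let Cbig : Matrix (J × ι) (K ⊕ Unit) ℤ := Matrix.of fun jc x ↦
    Sum.elim (fun k ↦ δ * ((b k) *ᵥ yv jc.1) jc.2) (fun _ ↦ -(Ψ (yv jc.1) * pb1 jc.2)) x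
  let lam : K ⊕ Unit → ℤ := Sum.elim (fun _ ↦ 0) (fun _ ↦ 1)
  have hlam : ∀ x : K ⊕ Unit → ℤ, lam ⬝ᵥ x = x (Sum.inr ()) := by
    intro x
    simp [lam, dotProduct, Fintype.sum_sum_type]
  have hCbig : ∀ (x : K ⊕ Unit → ℤ) (jc : J × ι),
      (Cbig *ᵥ x) jc = δ * ((∑ k, x (Sum.inl k) • b k) *ᵥ yv jc.1) jc.2 - x (Sum.inr ()) * (Ψ (yv jc.1) * pb1 jc.2) := by
    intro x jc
    rw [sum_smul_mulVec]
    simp only [Cbig, mulVec, dotProduct, of_apply, Fintype.sum_sum_type, Sum.elim_inl, Sum.elim_inr,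
      Finset.univ_unique, Finset.sum_singleton, PUnit.default_eq_unit, Finset.sum_apply, Pi.smul_apply, smul_eq_mul,
      Finset.mul_sum]
    rw [sub_eq_add_neg]
    congr 1
    · exact Finset.sum_congr rfl fun k _ ↦ by rw [Finset.sum_mul]; exact Finset.sum_congr rfl fun _ _ ↦ by ring
    · ring
  -- integer solutions: the integral (C5′)
  have hR : ∀ x : K ⊕ Unit → ℤ, Cbig *ᵥ x = 0 → δ ∣ lam ⬝ᵥ x := by
    intro x hx
    rw [hlam]
    set C : Matrix ι ι ℤ := ∑ k, x (Sum.inl k) • b k with hCdef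
    have hC : C ∈ Algebra.adjoin ℤ G :=
      Subalgebra.sum_mem _ fun k _ ↦ Subalgebra.smul_mem _ (hb k) _
    refine hC5 C hC (x (Sum.inr ())) fun y hy ↦ ?_
    -- on the spanning vectors `y_j`, then on `Y` by linearity
    have hj : ∀ j, δ • (C *ᵥ yv j) = x (Sum.inr ()) • Ψ (yv j) • pb1 := by
      intro j
      funext c
      have h0 := congrFun hx (j, c)
      rw [hCbig, Pi.zero_apply, sub_eq_zero] at h0
      simp only [Pi.smul_apply, smul_eq_mul]
      rw [h0]
    have hlin : ∀ z ∈ Submodule.span ℤ (Set.range yv), δ • (C *ᵥ z) = x (Sum.inr ()) • Ψ z • pb1 := by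
      intro z hz
      induction hz using Submodule.span_induction with
      | mem z hz => obtain ⟨j, rfl⟩ := hz; exact hj j
      | zero => simp
      | add z z' _ _ ih ih' => rw [mulVec_add, smul_add, ih, ih', map_add, add_smul, smul_add]
      | smul n z _ ih =>
          rw [mulVec_smul, smul_comm, ih, map_smul, smul_eq_mul, mul_smul, smul_comm n]
    exact hlin y (hYle hy)
  -- the `S`-solution `(e, a)`
  let v : K ⊕ Unit → S := Sum.elim e (fun _ ↦ a)
  have hv : Cbig.map (algebraMap ℤ S) *ᵥ v = 0 := by
    funext jc
    obtain ⟨j, c⟩ := jc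
    have h0 := congrFun (hsol j) c
    simp only [Pi.smul_apply, Finset.sum_apply, smul_eq_mul] at h0
    have hcast : ∀ k, (((b k *ᵥ yv j) c : ℤ) : S) = ((b k).map (Int.castRingHom S) *ᵥ fun d ↦ ((yv j d : ℤ) : S)) c :=
      fun k ↦ congrFun (map_intCast_mulVec (S := S) (b k) (yv j)) c
    rw [Pi.zero_apply]
    calc (Cbig.map (algebraMap ℤ S) *ᵥ v) (j, c)
        = ∑ k, ((δ * (b k *ᵥ yv j) c : ℤ) : S) * e k + (((-(Ψ (yv j) * pb1 c) : ℤ) : ℤ) : S) * a := by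
          simp only [Cbig, v, mulVec, dotProduct, map_apply, of_apply, Fintype.sum_sum_type, Sum.elim_inl, Sum.elim_inr,
            Finset.univ_unique, Finset.sum_singleton, PUnit.default_eq_unit, eq_intCast]
      _ = (δ : S) * ∑ k, e k * ((b k).map (Int.castRingHom S) *ᵥ fun d ↦ ((yv j d : ℤ) : S)) c -
            a * (((Ψ (yv j) : ℤ) : S) * ((pb1 c : ℤ) : S)) := by
          rw [Finset.mul_sum]
          simp only [Int.cast_mul, Int.cast_neg, hcast]
          rw [sub_eq_add_neg]
          congr 1
          · exact Finset.sum_congr rfl fun k _ ↦ by ring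
          · ring
      _ = 0 := by rw [h0, sub_self]
  have hdvd := dvd_dotProduct_of_map_mulVec_eq_zero (R := ℤ) (S := S) Cbig lam δ hR v hv
  have hlamv : (fun i ↦ algebraMap ℤ S (lam i)) ⬝ᵥ v = a := by
    simp [lam, v, dotProduct, Fintype.sum_sum_type]
  rw [hlamv, algebraMap_int_eq, Int.coe_castRingHom] at hdvd
  exact hdvd

end Summit.BirchSwinnertonDyer.BirchSwinnertonDyer.Theorems.LeafPartnerOrders

end
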